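import Mathlib
import Summits.Ventures.HodgeRepro.OcticCMPointGaloisRing16Sign

/-!
# OcticCMPointGaloisRing16Norm — every `σ`-fixed unit of `GR(16, 4)` is a norm; the conductor-`4` root number at `𝔮` is `ω(ϖ)^n` EXACTLY

Blind re-derivation cell `pub-hodge-repro`, seat night-2 (gen 5).  Target tree path
`lean/Summits/Ventures/HodgeRepro/OcticCMPointGaloisRing16Norm.lean`.  Closes the REMARK of
`OcticCMPointGaloisRing16Sign.lean`: the sign `ρ(a₀)` at the `σ`-fixed representative of the stationary point is `+1`,
because **every `σ`-fixed unit of `GR(16, 4) = 𝒪/𝔮⁴` is a norm `v σ(v)`** (`exists_norm`) and a conjugate-dual `ρ` is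
trivial on norms (`ρ(vσ(v)) = ρ(v)ρ(v)⁻¹ = 1`).

* **Hensel on the model.**  `T = r + σ(r) = 15 + 14r + 2r² + 4r³` is a `σ`-fixed unit (inverse `11 + 14r + 2r² + 4r³`).
  For `t` `σ`-fixed, the iteration `g(y) = T⁻¹(t − 2r⁵y²)` contracts `2`-adically (`gIter_sub`: `y ≡ y'` mod `2^k` ⇒
  `g(y) ≡ g(y')` mod `2^{k+1}`), so `y = g³(0)` satisfies `T y + 2r⁵y² ≡ t` mod `8` (`hensel_spec`) and
  **`N(1 + 2yr) = (1 + 2yr)(1 + 2yr⁴) = 1 + 2y(r + r⁴) + 4y²r⁵ = 1 + 2t`** (`norm_one_add`).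
* **The decomposition of a `σ`-fixed unit.**  `a₀ = α + βr⁵` (`fixedEl α β`) is a unit iff `(α, β) ≢ (0, 0)` mod `2`;
  then `a₀ = r^{5m}(1 + 2(γ + δr⁵))` with `m ∈ {0, 1, 2}` by the residue of `a₀` in `𝔽₄^× = {1, r̄⁵, r̄¹⁰ = 1 + r̄⁵}`
  (`r¹⁰ = 15 + 15r⁵`; the scalars `γ, δ` by halving in `ℤ/16`, `decomp_fixedEl`), and `N(r^m) = r^{5m}`, so
  `a₀ = N(r^m (1 + 2 y r))` (`exists_norm`).
* **`eps_four_inert_exact`**: for EVERY conjugate-dual character `ρ` of conductor exactly `4` at `𝔮`,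
  `ε(½, ρ, ψ̃_δ) = ρ(ϖ)^n` — the unit part contributes nothing, as at conductor `1` (`OcticCMPointInertGauss`) and `2`
  (`OcticCMPointGaloisRingE3`); `E3_four_inert_exact`: (E3) at `𝔮`, conductor `4`, across ALL lines is the `ϖ`-part of N2.

Numerics: `numerics/gr164_norm.py` (all `192` `σ`-fixed units are norms; the Hensel iteration closes for all `256` `t`).

**What this is not.**  Odd conductors at `𝔮` and the four `χ′_j` of the face are NOT here.  Nothing here says anything
about the status of the Hodge conjecture for CM abelian varieties, which is NOT proved.
-/

set_option autoImplicit false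

noncomputable section

open Polynomial Classical

namespace Summit.Ventures.HodgeRepro.PeriodCloser

namespace GaloisRing16

open GaussSumStability

/-! ### `T = r + σ(r)` and its inverse -/

/-- `T = r + r⁴ = 15 + 14r + 2r² + 4r³`, the relative trace of `r`. -/
def T : GR164 := 15 + 14 * r + 2 * r ^ 2 + 4 * r ^ 3

/-- `T = r + r⁴`. -/
theorem T_eq : T = r + r ^ 4 := by
  have hrel := r_rel
  have h16 := sixteen_eq_zero
  unfold T
  linear_combination (-1 : GR164) * hrel + (1 + r + r ^ 2 + r ^ 3) * h16

/-- `σ(T) = T`. -/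
theorem conjGR_T : conjGR T = T := by
  rw [T_eq, map_add, conjGR_r, map_pow, conjGR_r, ← pow_mul, r_pow_sixteen, add_comm]

/-- The inverse of `T`: `11 + 14r + 2r² + 4r³`. -/
def Tinv : GR164 := 11 + 14 * r + 2 * r ^ 2 + 4 * r ^ 3

/-- `T · T⁻¹ = 1`. -/
theorem T_mul_Tinv : T * Tinv = 1 := by
  have hrel := r_rel
  have h16 := sixteen_eq_zero
  unfold T Tinv
  linear_combination ((2004 : GR164) + (-176 : GR164) * r + (16 : GR164) * r ^ 2) * hrel + ((-115 : GR164) + (-342 : GR164) * r + (-1706 : GR164) * r ^ 2 + (-1342 : GR164) * r ^ 3) * h16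

/-- `σ(T⁻¹) = T⁻¹`. -/
theorem conjGR_Tinv : conjGR Tinv = Tinv := by
  have h' : T * conjGR Tinv = 1 := by rw [← conjGR_T, ← map_mul, T_mul_Tinv, map_one]
  calc conjGR Tinv = (T * Tinv) * conjGR Tinv := by rw [T_mul_Tinv, one_mul]
    _ = Tinv * (T * conjGR Tinv) := by ring
    _ = Tinv := by rw [h', mul_one]

/-- `r¹⁰ = 15 + 15 r⁵` (the cube root of unity `r⁵`: `r¹⁰ + r⁵ + 1 = 0`). -/
theorem r_pow_ten : r ^ 10 = 15 + 15 * r ^ 5 := by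
  have hrel := r_rel
  have h16 := sixteen_eq_zero
  linear_combination ((1718561 : GR164) + (-160323 : GR164) * r + (14955 : GR164) * r ^ 2 + (-1395 : GR164) * r ^ 3 + (130 : GR164) * r ^ 4 + (-12 : GR164) * r ^ 5 + (1 : GR164) * r ^ 6) * hrel + ((-107411 : GR164) + (-312210 : GR164) * r + (-1474615 : GR164) * r ^ 2 + (-1151355 : GR164) * r ^ 3) * h16

/-! ### The Hensel iteration -/

/-- The iteration `g(y) = T⁻¹ (t − 2 r⁵ y²)`. -/
def gIter (t y : GR164) : GR164 := Tinv * (t - 2 * r ^ 5 * y ^ 2)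

/-- **The iteration contracts `2`-adically**: `y − y' = 2^k w` ⇒ `g(y) − g(y') = 2^{k+1} w'`. -/
theorem gIter_sub (t y y' : GR164) (k : ℕ) (w : GR164) (h : y - y' = 2 ^ k * w) :
    ∃ w', gIter t y - gIter t y' = 2 ^ (k + 1) * w' := by
  refine ⟨-(Tinv * r ^ 5 * w * (y + y')), ?_⟩
  unfold gIter
  rw [pow_succ]
  linear_combination (-(2 * Tinv * r ^ 5 * (y + y'))) * h

/-- `σ` preserves the iteration for `σ`-fixed `t`, `y`. -/
theorem conjGR_gIter (t y : GR164) (ht : conjGR t = t) (hy : conjGR y = y) : conjGR (gIter t y) = gIter t y := by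
  unfold gIter
  rw [map_mul, conjGR_Tinv, map_sub, ht, map_mul, map_mul, map_ofNat, conjGR_r_pow_five, map_pow, hy]

/-- The Hensel solution `y = g³(0)`. -/
def hensel (t : GR164) : GR164 := gIter t (gIter t (gIter t 0))

/-- `σ(hensel t) = hensel t` for `σ`-fixed `t`. -/
theorem conjGR_hensel (t : GR164) (ht : conjGR t = t) : conjGR (hensel t) = hensel t := by
  unfold hensel
  exact conjGR_gIter t _ ht (conjGR_gIter t _ ht (conjGR_gIter t _ ht (map_zero _)))

/-- **`T y + 2 r⁵ y² ≡ t` mod `8`** for `y = hensel t`. -/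
theorem hensel_spec (t : GR164) : ∃ w, T * hensel t + 2 * r ^ 5 * hensel t ^ 2 - t = 8 * w := by
  obtain ⟨w1, h1⟩ := gIter_sub t (gIter t 0) 0 0 (gIter t 0) (by rw [pow_zero, one_mul, sub_zero])
  obtain ⟨w2, h2⟩ := gIter_sub t _ _ 1 w1 h1
  obtain ⟨w3, h3⟩ := gIter_sub t _ _ 2 w2 h2
  refine ⟨-(T * w3), ?_⟩
  set y₃ := gIter t (gIter t (gIter t 0)) with hy₃
  have h4 : gIter t y₃ = Tinv * (t - 2 * r ^ 5 * y₃ ^ 2) := rfl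
  rw [h4] at h3
  have hT := T_mul_Tinv
  unfold hensel
  rw [← hy₃]
  linear_combination (-T) * h3 + (t - 2 * r ^ 5 * y₃ ^ 2) * hT

/-- **`N(1 + 2 y r) = 1 + 2t`** for `y = hensel t`, `t` `σ`-fixed: `(1 + 2yr)(1 + 2yr⁴) = 1 + 2yT + 4y²r⁵`. -/
theorem norm_one_add (t : GR164) (ht : conjGR t = t) :
    (1 + 2 * hensel t * r) * conjGR (1 + 2 * hensel t * r) = 1 + 2 * t := by
  have hy := conjGR_hensel t ht
  obtain ⟨w, hw⟩ := hensel_spec t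
  rw [map_add, map_one, map_mul, map_mul, map_ofNat, hy, conjGR_r]
  have h16 := sixteen_eq_zero
  have hT := T_eq
  linear_combination 2 * hw - 2 * hensel t * hT + w * h16

/-! ### The `σ`-fixed units `α + β r⁵` and their decomposition -/

/-- The element `α + β r⁵` of the `σ`-fixed subring `GR(16, 2)`. -/
def fixedEl (α β : ZMod 16) : GR164 := algebraMap (ZMod 16) GR164 α + algebraMap (ZMod 16) GR164 β * r ^ 5

/-- `fixedEl` is `σ`-fixed. -/
theorem conjGR_fixedEl (α β : ZMod 16) : conjGR (fixedEl α β) = fixedEl α β := by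
  unfold fixedEl
  rw [map_add, AlgHom.commutes, map_mul, AlgHom.commutes, conjGR_r_pow_five]

/-- `N(r^m) = r^{5m}`. -/
theorem norm_r_pow (m : ℕ) : r ^ m * conjGR (r ^ m) = r ^ (5 * m) := by
  rw [map_pow, conjGR_r, ← pow_mul, ← pow_add]
  congr 1
  ring

/-- Halving in `ℤ/16`: `half e = e.val / 2`. -/
def half (e : ZMod 16) : ZMod 16 := ((e.val / 2 : ℕ) : ZMod 16)

/-- `2 · half e = e` for even `e`. -/
theorem two_mul_half (e : ZMod 16) (he : e.val % 2 = 0) : 2 * half e = e := by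
  revert e; decide

/-- The coordinate identities of the three decompositions, as a statement about `ℤ/16`. -/
theorem decomp_scalars (α β : ZMod 16) (h : ¬ (α.val % 2 = 0 ∧ β.val % 2 = 0)) :
    (α.val % 2 = 1 ∧ β.val % 2 = 0 ∧ 1 + 2 * half (α - 1) = α ∧ 2 * half β = β) ∨
    (α.val % 2 = 0 ∧ β.val % 2 = 1 ∧ 14 * (7 * half α) = α ∧
      1 + 2 * half (β - 1 - 14 * (7 * half α)) + 14 * (7 * half α) = β) ∨
    (α.val % 2 = 1 ∧ β.val % 2 = 1 ∧ 15 * (1 + 2 * (7 * half (β - 15))) + 2 * half (α - 15 - 14 * (7 * half (β - 15))) = α ∧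
      15 * (1 + 2 * (7 * half (β - 15))) = β) := by
  revert α β; decide

/-- `r⁵ (1 + 2 fixedEl γ δ) = fixedEl (14δ) (1 + 2γ + 14δ)`. -/
theorem r_pow_five_mul_one_add (γ δ : ZMod 16) :
    r ^ 5 * (1 + 2 * fixedEl γ δ) = fixedEl (14 * δ) (1 + 2 * γ + 14 * δ) := by
  unfold fixedEl
  simp only [map_add, map_mul, map_one, map_ofNat]
  have h10 := r_pow_ten
  have h16 := sixteen_eq_zero
  linear_combination (2 * algebraMap (ZMod 16) GR164 δ) * h10 +
    (algebraMap (ZMod 16) GR164 δ + algebraMap (ZMod 16) GR164 δ * r ^ 5) * h16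

/-- `r¹⁰ (1 + 2 fixedEl γ δ) = fixedEl (15(1 + 2γ) + 2δ) (15(1 + 2γ))`. -/
theorem r_pow_ten_mul_one_add (γ δ : ZMod 16) :
    r ^ 10 * (1 + 2 * fixedEl γ δ) = fixedEl (15 * (1 + 2 * γ) + 2 * δ) (15 * (1 + 2 * γ)) := by
  unfold fixedEl
  simp only [map_add, map_mul, map_one, map_ofNat]
  have h10 := r_pow_ten
  have h15 := r_pow_fifteen
  linear_combination (1 + 2 * algebraMap (ZMod 16) GR164 γ) * h10 + (2 * algebraMap (ZMod 16) GR164 δ) * h15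

/-- **Every `σ`-fixed unit `α + β r⁵` is `r^{5m} (1 + 2(γ + δ r⁵))`** with `m ∈ {0, 1, 2}` (the residue in `𝔽₄^×`). -/
theorem decomp_fixedEl (α β : ZMod 16) (h : ¬ (α.val % 2 = 0 ∧ β.val % 2 = 0)) :
    ∃ (m : ℕ) (γ δ : ZMod 16), fixedEl α β = r ^ (5 * m) * (1 + 2 * fixedEl γ δ) := by
  rcases decomp_scalars α β h with ⟨-, -, h1, h2⟩ | ⟨-, -, h1, h2⟩ | ⟨-, -, h1, h2⟩
  · refine ⟨0, half (α - 1), half β, ?_⟩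
    rw [mul_zero, pow_zero, one_mul]
    calc fixedEl α β = fixedEl (1 + 2 * half (α - 1)) (2 * half β) := by conv_rhs => rw [h1, h2]
      _ = 1 + 2 * fixedEl (half (α - 1)) (half β) := by
          unfold fixedEl
          simp only [map_add, map_mul, map_one, map_ofNat]
          ring
  · refine ⟨1, half (β - 1 - 14 * (7 * half α)), 7 * half α, ?_⟩
    rw [mul_one, r_pow_five_mul_one_add]
    calc fixedEl α β = fixedEl (14 * (7 * half α)) (1 + 2 * half (β - 1 - 14 * (7 * half α)) + 14 * (7 * half α)) := by
          conv_rhs => rw [h2, h1]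
      _ = _ := rfl
  · refine ⟨2, 7 * half (β - 15), half (α - 15 - 14 * (7 * half (β - 15))), ?_⟩
    rw [show 5 * 2 = 10 by norm_num, r_pow_ten_mul_one_add]
    calc fixedEl α β = fixedEl (15 * (1 + 2 * (7 * half (β - 15))) + 2 * half (α - 15 - 14 * (7 * half (β - 15))))
          (15 * (1 + 2 * (7 * half (β - 15)))) := by conv_rhs => rw [h1, h2]
      _ = _ := rfl

/-- A `σ`-fixed element with both coordinates even is nilpotent, hence not a unit. -/
theorem not_isUnit_fixedEl_of_even (α β : ZMod 16) (hα : α.val % 2 = 0) (hβ : β.val % 2 = 0) :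
    ¬ IsUnit (fixedEl α β) := by
  intro hu
  have h2 : fixedEl α β = 2 * fixedEl (half α) (half β) := by
    unfold fixedEl
    conv_lhs => rw [← two_mul_half α hα, ← two_mul_half β hβ]
    simp only [map_mul, map_ofNat]
    ring
  obtain ⟨v, hv⟩ := hu.exists_right_inv
  have h16 := sixteen_eq_zero
  have hsq : fixedEl α β ^ 4 = 0 := by
    rw [h2]
    linear_combination (fixedEl (half α) (half β) ^ 4) * h16
  have : (1 : GR164) = 0 := by
    calc (1 : GR164) = (fixedEl α β * v) ^ 4 := by rw [hv, one_pow]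
      _ = fixedEl α β ^ 4 * v ^ 4 := by ring
      _ = 0 := by rw [hsq, zero_mul]
  exact absurd (algebraMap_injective (by rw [map_one, map_zero]; exact this : algebraMap (ZMod 16) GR164 1 =
    algebraMap (ZMod 16) GR164 0)) (by decide)

/-- **Every `σ`-fixed unit of the form `α + β r⁵` is a norm** `v σ(v)`. -/
theorem exists_norm (α β : ZMod 16) (hu : IsUnit (fixedEl α β)) :
    ∃ v : GR164, v * conjGR v = fixedEl α β := by
  have hpar : ¬ (α.val % 2 = 0 ∧ β.val % 2 = 0) := fun ⟨hα, hβ⟩ => not_isUnit_fixedEl_of_even α β hα hβ hu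
  obtain ⟨m, γ, δ, hdec⟩ := decomp_fixedEl α β hpar
  refine ⟨r ^ m * (1 + 2 * hensel (fixedEl γ δ) * r), ?_⟩
  rw [map_mul, show r ^ m * (1 + 2 * hensel (fixedEl γ δ) * r) * (conjGR (r ^ m) * conjGR (1 + 2 * hensel (fixedEl γ δ) * r)) =
      (r ^ m * conjGR (r ^ m)) * ((1 + 2 * hensel (fixedEl γ δ) * r) * conjGR (1 + 2 * hensel (fixedEl γ δ) * r)) by ring,
    norm_r_pow, norm_one_add _ (conjGR_fixedEl γ δ), hdec]

/-! ### The conductor-`4` root number at `𝔮` is `ω(ϖ)^n` exactly -/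

/-- A conjugate-dual character is trivial on norms: `ρ(v σ(v)) = ρ(v) ρ(v)⁻¹ = 1` (`v` a unit). -/
theorem mulChar_norm_eq_one (ρ : MulChar GR164 ℂ) (hσ : ∀ x, ρ (conjGR x) = ρ⁻¹ x) (v : GR164)
    (hv : IsUnit (v * conjGR v)) : ρ (v * conjGR v) = 1 := by
  have hvu : IsUnit v := (IsUnit.mul_iff.1 hv).1
  have hne : ρ v ≠ 0 := by
    intro h
    obtain ⟨u, rfl⟩ := hvu
    have := ρ.map_one
    rw [← Units.mul_inv u, map_mul, h, zero_mul] at this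
    exact zero_ne_one this
  rw [map_mul, hσ, MulChar.inv_apply_eq_inv', mul_inv_cancel₀ hne]

/-- **The sign at the `σ`-fixed representative is `+1`**: a conjugate-dual `ρ` is trivial on the `σ`-fixed units
`α + β r⁵`. -/
theorem mulChar_fixedEl_eq_one (ρ : MulChar GR164 ℂ) (hσ : ∀ x, ρ (conjGR x) = ρ⁻¹ x) (α β : ZMod 16)
    (hu : IsUnit (fixedEl α β)) : ρ (fixedEl α β) = 1 := by
  obtain ⟨v, hv⟩ := exists_norm α β hu
  rw [← hv]
  exact mulChar_norm_eq_one ρ hσ v (hv ▸ hu)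

/-- The `σ`-fixed representative of `exists_fixed_lift` is a `fixedEl`, restated. -/
theorem exists_fixed_lift' (a : GR164) (h : conjGR a - a ∈ I4) :
    ∃ α β : ZMod 16, a - fixedEl α β ∈ I4 := by
  have hres : sigmaRes (red4 a) = red4 a := by
    rw [← red4_conjGR]
    exact (sub_mem_I4_iff _ _).1 h
  obtain ⟨α, β, hv⟩ := sigmaRes_fixed (red4 a) hres
  refine ⟨((α.val : ℕ) : ZMod 16), ((β.val : ℕ) : ZMod 16), ?_⟩
  rw [sub_mem_I4_iff]
  unfold fixedEl
  rw [Algebra.algebraMap_eq_smul_one (((α.val : ℕ) : ZMod 16)), ← smul_eq_num, red4_add, red4_smul, red4_smul,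
    red4_one, red4_r_pow_five, c4_lift, c4_lift]
  exact hv

/-- **The conductor-`4` root number at `𝔮 | 2` of EVERY conjugate-dual character is `ω(ϖ)^n` exactly**: for `ρ` with
`ρ ∘ σ = ρ⁻¹` and `ρ(1 + z) = ψ̃_δ(a z)` on `4GR` (`a` a unit), `ε(½, ρ, ψ̃_δ) = ρ(ϖ)^n` (`κ = 1/256`) — the unit part
contributes nothing, as at conductors `1` and `2`. -/
theorem eps_four_inert_exact (n : ℕ) (ρ : LocalChar GR164) (hσ : ∀ x, ρ.unit (conjGR x) = ρ.unit⁻¹ x) (a : GR164ˣ)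
    (hρ : LocalChar.Primitive psiTildeGR16 I4 ρ a) :
    LocalChar.eps (1 / 256) n ρ psiTildeGR16 = ρ.piVal ^ n := by
  have hσ' : ∀ x, ρ.unit (σ16 x) = ρ.unit⁻¹ x := fun x => by rw [σ16_apply]; exact hσ x
  have hψσ : ∀ x, psiTildeGR16 (σ16 x) = psiTildeGR16 (-x) := fun x => by rw [σ16_apply]; exact psiTildeGR16_conjGR x
  have hconj : σ16 (a : GR164) - a ∈ I4 :=
    LocalChar.conj_sub_mem psiTildeGR16 I4 psiAnn_I4_iff σ16 (fun x => by rw [σ16_apply, σ16_apply]; exact conjGR_conjGR x)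
      (fun z hz => by rw [σ16_apply]; exact conj_mem_I4 z hz) hψσ ρ hσ' a hρ
  rw [σ16_apply] at hconj
  obtain ⟨α, β, hsub⟩ := exists_fixed_lift' a hconj
  have hu := isUnit_of_sub_mem_I4 a _ hsub
  obtain ⟨h1, -, -⟩ := LocalChar.eps_eq_of_conjDual (1 / 256) n ρ psiTildeGR16 I4 I4_sq psiAnn_I4_iff σ16 hσ' hψσ a hρ
    kappa_mul_card hu.unit (by rw [IsUnit.unit_spec, σ16_apply]; exact conjGR_fixedEl α β)
    (by rw [IsUnit.unit_spec]; exact hsub)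
  rw [h1, IsUnit.unit_spec, psiTildeGR16_eq_one_of_conjGR_fixed (conjGR_fixedEl α β),
    mulChar_fixedEl_eq_one ρ.unit hσ α β hu, inv_one, mul_one, mul_one]

/-- **(E3) at `𝔮 | 2`, conductor `4`, across ALL lines**: for four conjugate-dual characters of conductor exactly `4`,
`ε₀ε₁ = ε₂ε₃` is exactly the `ϖ`-part `π₀π₁ = π₂π₃` of N2. -/
theorem E3_four_inert_exact (n : ℕ) (ρ : Fin 4 → LocalChar GR164)
    (hσ : ∀ j x, (ρ j).unit (conjGR x) = (ρ j).unit⁻¹ x) (a : Fin 4 → GR164ˣ)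
    (hρ : ∀ j, LocalChar.Primitive psiTildeGR16 I4 (ρ j) (a j))
    (hN2 : (ρ 0).piVal * (ρ 1).piVal = (ρ 2).piVal * (ρ 3).piVal) :
    LocalChar.eps (1 / 256) n (ρ 0) psiTildeGR16 * LocalChar.eps (1 / 256) n (ρ 1) psiTildeGR16 =
      LocalChar.eps (1 / 256) n (ρ 2) psiTildeGR16 * LocalChar.eps (1 / 256) n (ρ 3) psiTildeGR16 := by
  rw [eps_four_inert_exact n (ρ 0) (hσ 0) (a 0) (hρ 0), eps_four_inert_exact n (ρ 1) (hσ 1) (a 1) (hρ 1),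
    eps_four_inert_exact n (ρ 2) (hσ 2) (a 2) (hρ 2), eps_four_inert_exact n (ρ 3) (hσ 3) (a 3) (hρ 3), ← mul_pow, hN2,
    mul_pow]

end GaloisRing16

end Summit.Ventures.HodgeRepro.PeriodCloser

end
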